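import Mathlib
import Literature.Topology.FourManifolds.OpenCollar
import Literature.Geometry.Manifold.TimeDerivativeSmooth
import Literature.Geometry.Lorentzian.CurvatureRegularity

/-!
# Stub `stub_normalPairContinuous` (crux `AhHadamardFilling`, line `einstein-bulk-transfer`)

Continuity of the normal pair `x ↦ (z x, θ x)` along the boundary of an open collar
`κ = uncurry D.toFun : M × [0, ∞) → X`.  The quadratic identity
`ḡ(dκ(v + s z, s θ), dκ(v + s z, s θ)) = (θ a₀)² (s² + g₀(v, v))` determines the pair by the
explicit formulas `θ = √(ḡ(dκ(u,0), dκ(u,0)) / (a₀² g₀(u,u)))` and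
`g₀(u, z) = -ḡ(dκ(u,0), dκ(0,1)) / (θ a₀²)`; in a local frame `u = f_k` of `TM` these are
continuous (continuity of `tangentMapWithin κ`, of the metrics on the tangent bundles, of
`a₀ = ∂ₜ(ρ ∘ κ)(·, 0⁺)` by `Literature.Geometry.Manifold.continuousOn_derivWithin_time'`, and of
the inverse Gram matrix of `g₀`), and `z = Σ (G⁻¹ p)_l f_l` is then a continuous section.
-/

noncomputable section

set_option linter.dupNamespace false

open scoped Manifold ContDiff Topology
open Set Function Bundle Literature.Topology.FourManifolds Literature.Geometry.Lorentzian

namespace Summit.SmoothPoincare4.SmoothPoincare4.Cruxes.AhHadamardFilling.EinsteinBulkTransfer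

section Algebra

variable {V W : Type*} [AddCommGroup V] [Module ℝ V] [TopologicalSpace V]
  [AddCommGroup W] [Module ℝ W] [TopologicalSpace W]

/-- Expansion of a symmetric bilinear form on `a + s • c`. -/
private theorem bilin_add_smul_self (β : W →L[ℝ] W →L[ℝ] ℝ) (hβ : ∀ p q, β p q = β q p)
    (a c : W) (s : ℝ) :
    β (a + s • c) (a + s • c) = β a a + 2 * s * β a c + s ^ 2 * β c c := by
  simp only [map_add, map_smul, add_apply, smul_apply, smul_eq_mul]
  rw [hβ c a]
  ring

/-- **The algebra of the normal pair.** If a symmetric bilinear form `β`, a linear map `L` on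
`V × ℝ`, a symmetric form `g` on `V`, a vector `z`, and scalars `θ > 0`, `A ≠ 0` satisfy
`β(L(v + s z, s θ), L(v + s z, s θ)) = (θ A)² (s² + g(v, v))` for all `v, s`, then
`θ = √(β(L(v,0), L(v,0)) / (A² g(v,v)))` whenever `g(v, v) ≠ 0`, and
`g(v, z) = -β(L(v,0), L(0,1)) / (θ A²)` (compare coefficients of `s` and polarize). -/
private theorem normalPair_algebra (L : V × ℝ →L[ℝ] W) (β : W →L[ℝ] W →L[ℝ] ℝ)
    (hβ : ∀ p q, β p q = β q p) (g : V →L[ℝ] V →L[ℝ] ℝ) (hg : ∀ v w, g v w = g w v)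
    (z : V) {θ A : ℝ} (hθ : 0 < θ) (hA : A ≠ 0)
    (h : ∀ (v : V) (s : ℝ),
      β (L (v + s • z, s * θ)) (L (v + s • z, s * θ)) = (θ * A) ^ 2 * (s ^ 2 + g v v)) :
    (∀ v : V, g v v ≠ 0 →
      θ = Real.sqrt (β (L (v, 0)) (L (v, 0)) / (A ^ 2 * g v v))) ∧
    (∀ v : V, g v z = -(β (L (v, 0)) (L (0, 1))) / (θ * A ^ 2)) := by
  -- expansion in powers of `s`
  have key : ∀ (v : V) (s : ℝ), β (L (v, 0)) (L (v, 0)) + 2 * s * β (L (v, 0)) (L (z, θ)) +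
      s ^ 2 * β (L (z, θ)) (L (z, θ)) = (θ * A) ^ 2 * (s ^ 2 + g v v) := by
    intro v s
    have e1 : ((v + s • z, s * θ) : V × ℝ) = (v, 0) + s • (z, θ) := by
      ext <;> simp
    rw [← h v s, e1, map_add, map_smul, bilin_add_smul_self β hβ]
  -- `s = 0`
  have h0 : ∀ v : V, β (L (v, 0)) (L (v, 0)) = (θ * A) ^ 2 * g v v := by
    intro v
    linear_combination key v 0
  -- `s = ± 1`: the horizontal space is `β`-orthogonal to `L (z, θ)`
  have horth : ∀ v : V, β (L (v, 0)) (L (z, θ)) = 0 := by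
    intro v
    linear_combination (key v 1 - key v (-1)) / 4
  -- polarization of `h0`
  have hpol : ∀ v w : V, β (L (v, 0)) (L (w, 0)) = (θ * A) ^ 2 * g v w := by
    intro v w
    have hvw := h0 (v + w)
    have e1 : ((v + w, 0) : V × ℝ) = (v, 0) + (w, 0) := by
      ext <;> simp
    rw [e1, map_add] at hvw
    simp only [map_add, add_apply] at hvw
    linear_combination (1 / 2 : ℝ) * hvw - (1 / 2 : ℝ) * hβ (L (w, 0)) (L (v, 0)) -
      (1 / 2 : ℝ) * h0 v - (1 / 2 : ℝ) * h0 w + ((θ * A) ^ 2 / 2) * hg w v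
  refine ⟨fun v hv => ?_, fun v => ?_⟩
  · rw [h0 v]
    have : (θ * A) ^ 2 * g v v / (A ^ 2 * g v v) = θ ^ 2 := by
      rw [div_eq_iff (mul_ne_zero (pow_ne_zero 2 hA) hv)]
      ring
    rw [this, Real.sqrt_sq hθ.le]
  · have h1 := horth v
    have e1 : ((z, θ) : V × ℝ) = (z, 0) + θ • ((0 : V), (1 : ℝ)) := by
      ext <;> simp
    rw [e1, map_add, map_smul, map_add, map_smul, smul_eq_mul, hpol v z] at h1
    have h2 : θ * (θ * A ^ 2 * g v z + β (L (v, 0)) (L (0, 1))) = 0 := by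
      linear_combination h1
    have h3 := (mul_eq_zero.1 h2).resolve_left hθ.ne'
    rw [eq_div_iff (mul_ne_zero hθ.ne' (pow_ne_zero 2 hA))]
    linear_combination h3

/-- **Coordinates of a vector from its pairings with a basis.** For a bilinear form `B` whose
Gram matrix `G` in the basis `β` is invertible, `β.repr u i = Σ_k (G⁻¹)_{ik} B(β_k, u)`
(`B(β_k, u) = (G c)_k` for the coordinate vector `c`). -/
private theorem basis_repr_eq_sum_gram_inv {ι : Type*} [Fintype ι] [DecidableEq ι]
    (β : Module.Basis ι ℝ W) (B : W →L[ℝ] W →L[ℝ] ℝ)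
    (hG : (Matrix.of fun i j => B (β i) (β j)).det ≠ 0) (u : W) (i : ι) :
    β.repr u i = ∑ k, (Matrix.of fun i j => B (β i) (β j))⁻¹ i k * B (β k) u := by
  set G : Matrix ι ι ℝ := Matrix.of fun i j => B (β i) (β j) with hG_def
  have hp : (fun k => B (β k) u) = G.mulVec ⇑(β.repr u) := by
    funext k
    conv_lhs => rw [← β.sum_repr u]
    rw [Matrix.mulVec_apply_eq_sum]
    simp only [map_sum, map_smul, smul_eq_mul, hG_def, Matrix.of_apply]
    exact Finset.sum_congr rfl fun l _ => mul_comm _ _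
  have hc : G⁻¹.mulVec (G.mulVec ⇑(β.repr u)) = ⇑(β.repr u) := by
    rw [Matrix.mulVec_mulVec, Matrix.nonsing_inv_mul _ (isUnit_iff_ne_zero.2 hG),
      Matrix.one_mulVec]
  calc β.repr u i = (G⁻¹.mulVec (G.mulVec ⇑(β.repr u))) i := by rw [hc]
    _ = ∑ k, G⁻¹ i k * B (β k) u := by rw [← hp, Matrix.mulVec_apply_eq_sum]

end Algebra

section Inner

variable {EB : Type*} [NormedAddCommGroup EB] [NormedSpace ℝ EB] {HB : Type*}
  [TopologicalSpace HB] {IB : ModelWithCorners ℝ EB HB} {B : Type*} [TopologicalSpace B]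
  [ChartedSpace HB B] [IsManifold IB 1 B] {n : ℕ∞ω} {N : Type*} [TopologicalSpace N]

-- adapted from Mathlib's `ContMDiffWithinAt.inner_bundle`
/-- The scalar product `g_{b m}(v m, w m)` of two continuous maps into the tangent bundle over
the same base map `b` is continuous (`ContinuousOn.clm_bundle_apply₂`). -/
private theorem continuousOn_inner_tangent
    (g : ContMDiffRiemannianMetric IB n EB (TangentSpace IB : B → Type _))
    {b : N → B} {v w : ∀ m, TangentSpace IB (b m)} {s : Set N}
    (hv : ContinuousOn (fun m => (⟨b m, v m⟩ : TangentBundle IB B)) s)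
    (hw : ContinuousOn (fun m => (⟨b m, w m⟩ : TangentBundle IB B)) s) :
    ContinuousOn (fun m => g.inner (b m) (v m) (w m)) s := by
  have hb : ContinuousOn b s :=
    (FiberBundle.continuous_proj EB (TangentSpace IB : B → Type _)).comp_continuousOn hv
  have hψ : ContinuousOn (fun m => TotalSpace.mk' (EB →L[ℝ] EB →L[ℝ] ℝ)
      (E := fun x : B => TangentSpace IB x →L[ℝ] TangentSpace IB x →L[ℝ] ℝ)
      (b m) (g.inner (b m))) s :=
    g.contMDiff.continuous.comp_continuousOn hb
  have h2 : ContinuousOn (fun m => TotalSpace.mk' ℝ (E := Bundle.Trivial B ℝ) (b m)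
      (g.inner (b m) (v m) (w m))) s :=
    hψ.clm_bundle_apply₂ (F₁ := EB) (F₂ := EB) hv hw
  exact ((Bundle.Trivial.homeomorphProd B ℝ).continuous.comp_continuousOn h2).snd

end Inner

/-- **Continuity of the normal pair.** In the setting of `stub_normalPairPointwise`, ANY choice
`x ↦ (z x, θ x)` of normal pairs (`θ > 0` and the quadratic identity at every `x`) is continuous:
the identity determines `θ² = ḡ(dκ(u,0),dκ(u,0)) / (a₀² g₀(u,u))` and
`g₀(u, z) = -ḡ(dκ(u,0), dκ(0,1)) / (θ a₀²)`, continuous expressions in a local frame `u = f_k`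
(continuity of `tangentMapWithin κ`, of the metrics on the tangent bundles, of `a₀` by
`Literature.Geometry.Manifold.continuousOn_derivWithin_time'`, and of the inverse Gram matrix of
`g₀`). [folklore] -/
theorem stub_normalPairContinuous
    (M : Type) [TopologicalSpace M] [T2Space M] [SecondCountableTopology M]
    [ChartedSpace (EuclideanSpace ℝ (Fin 4)) M] [IsManifold (𝓡 4) ∞ M] [CompactSpace M]
    (g₀ : Bundle.ContMDiffRiemannianMetric (𝓡 4) ∞ (EuclideanSpace ℝ (Fin 4))
      (TangentSpace (𝓡 4) : M → Type _))
    (X : Type) [TopologicalSpace X] [T2Space X] [SecondCountableTopology X]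
    [ChartedSpace (EuclideanHalfSpace 5) X] [IsManifold (𝓡∂ 5) ∞ X] [CompactSpace X]
    (ι : M → X) (hι : Manifold.IsSmoothEmbedding (𝓡 4) (𝓡∂ 5) ∞ ι)
    (hιr : Set.range ι = (𝓡∂ 5).boundary X)
    (ρ : X → ℝ) (hρ : ContMDiff (𝓡∂ 5) 𝓘(ℝ, ℝ) ∞ ρ)
    (gb : Bundle.ContMDiffRiemannianMetric (𝓡∂ 5) 2 (EuclideanSpace ℝ (Fin 5))
      (TangentSpace (𝓡∂ 5) : X → Type _))
    (φ : M → ℝ) (hφ : ∀ y : M, 0 < φ y ∧ ∀ v w : TangentSpace (𝓡 4) y,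
      gb.inner (ι y) (mfderiv (𝓡 4) (𝓡∂ 5) ι y v) (mfderiv (𝓡 4) (𝓡∂ 5) ι y w) =
        φ y * g₀.inner y v w)
    (D : BoundaryData.OpenCollar (⟨M, ι, hι, hιr⟩ : BoundaryData (𝓡∂ 5) X (𝓡 4)))
    (hVt : ContMDiff ((𝓡 4).prod 𝓘(ℝ, ℝ)) ((𝓡 4).prod 𝓘(ℝ, ℝ)).tangent ∞
      (fun p : M × ℝ =>
        (⟨p, ((0 : TangentSpace (𝓡 4) p.1), (1 : ℝ))⟩ : TangentBundle ((𝓡 4).prod 𝓘(ℝ, ℝ)) (M × ℝ))))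
    (ha₀ : ∀ x : M, 0 < derivWithin (fun t => ρ (D.toFun x t)) (Ici 0) 0)
    (z : (x : M) → TangentSpace (𝓡 4) x) (θ : M → ℝ) (hθ : ∀ x : M, 0 < θ x)
    (hzθ : ∀ (x : M) (v : TangentSpace (𝓡 4) x) (s : ℝ),
      gb.inner (ι x)
          (mfderivWithin ((𝓡 4).prod 𝓘(ℝ, ℝ)) (𝓡∂ 5) (uncurry D.toFun) (univ ×ˢ Ici 0) (x, 0)
            (v + s • z x, s * θ x))
          (mfderivWithin ((𝓡 4).prod 𝓘(ℝ, ℝ)) (𝓡∂ 5) (uncurry D.toFun) (univ ×ˢ Ici 0) (x, 0)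
            (v + s • z x, s * θ x)) =
        (θ x * derivWithin (fun t => ρ (D.toFun x t)) (Ici 0) 0) ^ 2 * (s ^ 2 + g₀.inner x v v)) :
    Continuous θ ∧ Continuous (fun x : M => (⟨x, z x⟩ : TangentBundle (𝓡 4) M)) := by
  -- the conformal factor and the vertical unit field are not needed for the continuity
  have _hφ := hφ
  have _hVt := hVt
  -- notation: the collar `κ`, its domain `S`, its differential `dκ x` at `(x, 0)`, and `a₀`
  set S : Set (M × ℝ) := (univ : Set M) ×ˢ Ici (0 : ℝ) with hS
  set κ : M × ℝ → X := uncurry D.toFun with hκ_def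
  set dκ : M → (EuclideanSpace ℝ (Fin 4) × ℝ →L[ℝ] EuclideanSpace ℝ (Fin 5)) :=
    fun x => mfderivWithin ((𝓡 4).prod 𝓘(ℝ, ℝ)) (𝓡∂ 5) κ S (x, 0) with hdκ
  set a₀ : M → ℝ := fun x => derivWithin (fun t => ρ (D.toFun x t)) (Ici 0) 0 with ha₀_def
  have hmemS : ∀ x : M, ((x, (0 : ℝ)) : M × ℝ) ∈ S := fun x => ⟨mem_univ _, self_mem_Ici⟩
  have hSU : UniqueMDiffOn ((𝓡 4).prod 𝓘(ℝ, ℝ)) S :=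
    uniqueMDiffOn_univ.prod (uniqueMDiffOn_iff_uniqueDiffOn.2 (uniqueDiffOn_Ici 0))
  have hκ : ContMDiffOn ((𝓡 4).prod 𝓘(ℝ, ℝ)) (𝓡∂ 5) ∞ κ S := D.contMDiffOn_toFun
  have hκ0 : ∀ x : M, κ (x, 0) = ι x := fun x => D.apply_zero x
  -- Step A: the algebraic consequences of the quadratic identity at each point
  have alg : ∀ x : M,
      (∀ v : EuclideanSpace ℝ (Fin 4), g₀.inner x v v ≠ 0 →
        θ x = Real.sqrt (gb.inner (ι x) (dκ x (v, 0)) (dκ x (v, 0)) /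
          (a₀ x ^ 2 * g₀.inner x v v))) ∧
      ∀ v : EuclideanSpace ℝ (Fin 4), g₀.inner x v (z x) =
        -(gb.inner (ι x) (dκ x (v, 0)) (dκ x (0, 1))) / (θ x * a₀ x ^ 2) :=
    fun x => normalPair_algebra (dκ x) (gb.inner (ι x)) (gb.symm (ι x)) (g₀.inner x)
      (g₀.symm x) (z x) (hθ x) (ha₀ x).ne' (hzθ x)
  -- Step B1: `a₀` is continuous
  have ha₀c : Continuous a₀ := by
    have hu : ContMDiffOn ((𝓡 4).prod 𝓘(ℝ, ℝ)) 𝓘(ℝ, ℝ) ∞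
        (fun p : M × ℝ => ρ (D.toFun p.1 p.2)) S := hρ.comp_contMDiffOn hκ
    have h := Literature.Geometry.Manifold.continuousOn_derivWithin_time' (I := 𝓡 4) (M := M)
      (u := fun t x => ρ (D.toFun x t)) (uniqueDiffOn_Ici 0) hu
    exact h.comp_continuous (continuous_id.prodMk continuous_const) fun x => hmemS x
  -- Step B2: the tangent map of the collar is continuous over `S`
  have hTκ : ContinuousOn (tangentMapWithin ((𝓡 4).prod 𝓘(ℝ, ℝ)) (𝓡∂ 5) κ S)
      (π (EuclideanSpace ℝ (Fin 4) × ℝ)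
        (TangentSpace ((𝓡 4).prod 𝓘(ℝ, ℝ)) : M × ℝ → Type _) ⁻¹' S) :=
    hκ.continuousOn_tangentMapWithin ENat.LEInfty.out hSU
  -- the lift of a continuous vector field `V` and a constant `c` to `dκ (V, c)` over `κ (·, 0)`
  have hlift : ∀ {U : Set M} {V : (x : M) → TangentSpace (𝓡 4) x} (c : ℝ),
      ContinuousOn (fun x => (⟨x, V x⟩ : TangentBundle (𝓡 4) M)) U →
      ContinuousOn (fun x => (⟨κ (x, 0), dκ x (V x, c)⟩ : TangentBundle (𝓡∂ 5) X)) U := by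
    intro U V c hV
    have hsymm : Continuous (equivTangentBundleProd (𝓡 4) M 𝓘(ℝ, ℝ) ℝ).symm :=
      (contMDiff_equivTangentBundleProd_symm (n := 0)).continuous
    have h1 : ContinuousOn (fun x => (⟨(x, (0 : ℝ)), (V x, c)⟩ :
        TangentBundle ((𝓡 4).prod 𝓘(ℝ, ℝ)) (M × ℝ))) U :=
      hsymm.comp_continuousOn
        (hV.prodMk (continuousOn_const (c := (⟨(0 : ℝ), c⟩ : TangentBundle 𝓘(ℝ, ℝ) ℝ))))
    exact hTκ.comp h1 fun x _ => hmemS x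
  -- the scalar products `ḡ(dκ (V, c), dκ (W, d))` are continuous
  have hbase : ∀ (y y' : X), y = y' → ∀ p q : EuclideanSpace ℝ (Fin 5),
      gb.inner y p q = gb.inner y' p q := by
    rintro y _ rfl p q
    rfl
  have hB : ∀ {U : Set M} {V W : (x : M) → TangentSpace (𝓡 4) x} (c d : ℝ),
      ContinuousOn (fun x => (⟨x, V x⟩ : TangentBundle (𝓡 4) M)) U →
      ContinuousOn (fun x => (⟨x, W x⟩ : TangentBundle (𝓡 4) M)) U →
      ContinuousOn (fun x => gb.inner (ι x) (dκ x (V x, c)) (dκ x (W x, d))) U := by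
    intro U V W c d hV hW
    refine (continuousOn_inner_tangent gb (hlift c hV) (hlift d hW)).congr fun x _ => ?_
    exact (hbase _ _ (hκ0 x) _ _).symm
  -- the frame data near a point
  set bE : Module.Basis (Fin 4) ℝ (EuclideanSpace ℝ (Fin 4)) :=
    (EuclideanSpace.basisFun (Fin 4) ℝ).toBasis with hbE
  have hfc : ∀ (x₀ : M) (i : Fin 4), ContinuousOn (fun x => (⟨x,
      (trivializationAt (EuclideanSpace ℝ (Fin 4)) (TangentSpace (𝓡 4) : M → Type _)
        x₀).localFrame bE i x⟩ : TangentBundle (𝓡 4) M))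
      (trivializationAt (EuclideanSpace ℝ (Fin 4)) (TangentSpace (𝓡 4) : M → Type _)
        x₀).baseSet :=
    fun x₀ i => ((trivializationAt (EuclideanSpace ℝ (Fin 4)) (TangentSpace (𝓡 4) : M → Type _)
      x₀).contMDiffOn_localFrame_baseSet (I := 𝓡 4) ∞ bE i).continuousOn
  have hGc : ∀ (x₀ : M) (i j : Fin 4), ContinuousOn (fun x => g₀.inner x
      ((trivializationAt (EuclideanSpace ℝ (Fin 4)) (TangentSpace (𝓡 4) : M → Type _)
        x₀).localFrame bE i x)
      ((trivializationAt (EuclideanSpace ℝ (Fin 4)) (TangentSpace (𝓡 4) : M → Type _)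
        x₀).localFrame bE j x))
      (trivializationAt (EuclideanSpace ℝ (Fin 4)) (TangentSpace (𝓡 4) : M → Type _)
        x₀).baseSet :=
    fun x₀ i j => (contMDiffOn_gram_localFrame _ (PseudoRiemannianMetric.ofRiemannian g₀)
      bE i j).continuousOn
  have hfne : ∀ (x₀ x : M), x ∈ (trivializationAt (EuclideanSpace ℝ (Fin 4))
      (TangentSpace (𝓡 4) : M → Type _) x₀).baseSet →
      g₀.inner x ((trivializationAt (EuclideanSpace ℝ (Fin 4)) (TangentSpace (𝓡 4) : M → Type _)
        x₀).localFrame bE 0 x)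
        ((trivializationAt (EuclideanSpace ℝ (Fin 4)) (TangentSpace (𝓡 4) : M → Type _)
        x₀).localFrame bE 0 x) ≠ 0 := by
    intro x₀ x hx
    refine (g₀.pos x _ ?_).ne'
    rw [Trivialization.localFrame_apply_of_mem_baseSet _ bE hx]
    exact (Trivialization.basisAt _ bE hx).ne_zero 0
  -- Step C: `θ` is continuous
  have hθU : ∀ x₀ : M, ContinuousOn θ (trivializationAt (EuclideanSpace ℝ (Fin 4))
      (TangentSpace (𝓡 4) : M → Type _) x₀).baseSet := by
    intro x₀
    set e := trivializationAt (EuclideanSpace ℝ (Fin 4)) (TangentSpace (𝓡 4) : M → Type _) x₀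
      with he
    have hcont : ContinuousOn (fun x => Real.sqrt
        (gb.inner (ι x) (dκ x (e.localFrame bE 0 x, 0)) (dκ x (e.localFrame bE 0 x, 0)) /
          (a₀ x ^ 2 * g₀.inner x (e.localFrame bE 0 x) (e.localFrame bE 0 x)))) e.baseSet := by
      refine ((hB 0 0 (hfc x₀ 0) (hfc x₀ 0)).div ((ha₀c.continuousOn.pow 2).mul (hGc x₀ 0 0))
        fun x hx => ?_).sqrt
      exact mul_ne_zero (pow_ne_zero 2 (ha₀ x).ne') (hfne x₀ x hx)
    refine hcont.congr fun x hx => ?_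
    exact (alg x).1 _ (hfne x₀ x hx)
  have hθc : Continuous θ :=
    continuous_iff_continuousAt.2 fun x₀ => (hθU x₀).continuousAt
      ((trivializationAt (EuclideanSpace ℝ (Fin 4)) (TangentSpace (𝓡 4) : M → Type _)
        x₀).open_baseSet.mem_nhds (FiberBundle.mem_baseSet_trivializationAt' x₀))
  -- Step D: `z` is continuous
  have hzU : ∀ x₀ : M, ContinuousOn (fun x : M => (⟨x, z x⟩ : TangentBundle (𝓡 4) M))
      (trivializationAt (EuclideanSpace ℝ (Fin 4)) (TangentSpace (𝓡 4) : M → Type _)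
        x₀).baseSet := by
    intro x₀
    set e := trivializationAt (EuclideanSpace ℝ (Fin 4)) (TangentSpace (𝓡 4) : M → Type _) x₀
      with he
    have h0c : ContinuousOn (fun x : M => (⟨x, (0 : TangentSpace (𝓡 4) x)⟩ :
        TangentBundle (𝓡 4) M)) e.baseSet :=
      (Trivialization.continuous_zeroSection ℝ (F := EuclideanSpace ℝ (Fin 4))
        (E := (TangentSpace (𝓡 4) : M → Type _))).continuousOn
    -- the pairings `p_k = g₀(f_k, z)` are continuous
    have hp : ∀ k : Fin 4,
        ContinuousOn (fun x => g₀.inner x (e.localFrame bE k x) (z x)) e.baseSet := by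
      intro k
      have h2 : ContinuousOn (fun x =>
          -(gb.inner (ι x) (dκ x (e.localFrame bE k x, 0)) (dκ x (0, 1))) /
            (θ x * a₀ x ^ 2)) e.baseSet :=
        (hB 0 1 (hfc x₀ k) h0c).neg.div (hθc.continuousOn.mul (ha₀c.continuousOn.pow 2))
          fun x _ => mul_ne_zero (hθ x).ne' (pow_ne_zero 2 (ha₀ x).ne')
      refine h2.congr fun x _ => ?_
      exact (alg x).2 _
    -- the inverse Gram matrix is continuous
    have hGinv : ∀ i j : Fin 4, ContinuousOn (fun x =>
        (Matrix.of fun i j => g₀.inner x (e.localFrame bE i x) (e.localFrame bE j x))⁻¹ i j)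
        e.baseSet :=
      fun i j => (contMDiffOn_gram_localFrame_inv e (PseudoRiemannianMetric.ofRiemannian g₀)
        bE i j).continuousOn
    -- hence the frame coefficients of `z` are continuous
    have hcoeff : ∀ i : Fin 4,
        ContinuousOn (fun x => e.localFrame_coeff (𝓡 4) bE i x (z x)) e.baseSet := by
      intro i
      have h1 : ContinuousOn (fun x => ∑ k,
          (Matrix.of fun i j => g₀.inner x (e.localFrame bE i x) (e.localFrame bE j x))⁻¹ i k *
            g₀.inner x (e.localFrame bE k x) (z x)) e.baseSet :=
        continuousOn_finsetSum _ fun k _ => (hGinv i k).mul (hp k)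
      refine h1.congr fun x hx => ?_
      rw [e.localFrame_coeff_apply_of_mem_baseSet bE hx z i]
      simp only [e.localFrame_apply_of_mem_baseSet bE hx]
      exact basis_repr_eq_sum_gram_inv (e.basisAt bE hx) (g₀.inner x)
        (det_gram_ne_zero (PseudoRiemannianMetric.ofRiemannian g₀) x (e.basisAt bE hx)) (z x) i
    have h := (contMDiffOn_baseSet_iff_localFrame_coeff (I := 𝓡 4) (k := 0) (s := z) (e := e)
      bE).2 fun i => contMDiffOn_zero_iff.2 (hcoeff i)
    exact contMDiffOn_zero_iff.1 h
  exact ⟨hθc, continuous_iff_continuousAt.2 fun x₀ => (hzU x₀).continuousAt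
    ((trivializationAt (EuclideanSpace ℝ (Fin 4)) (TangentSpace (𝓡 4) : M → Type _)
      x₀).open_baseSet.mem_nhds (FiberBundle.mem_baseSet_trivializationAt' x₀))⟩

end Summit.SmoothPoincare4.SmoothPoincare4.Cruxes.AhHadamardFilling.EinsteinBulkTransfer

end
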